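/- Width seat `ym-line-cbag-p1-w2` (prover-ym-line-cbag-p1-w2-g14-0) on the planner-of-record's LINE 5, route `HankelDensitySplitting`:
helper for REGISTERED STUB B `stub_freeKernelMargin` of the birth skeleton v2 of crux `LogWindowMixedDominance` (stmt-QuantumFields-26617).
Pure lattice-Green-function analysis; RECORD-type material (node `LatticeNonFreezing`); the Yang–Mills mass gap is NOT proved by anything
here, and the crux stays open. -/
import Summits.QuantumFields.YangMills.Theorems.LogWindowMixedDominanceGreenMixedRepr
import Summits.QuantumFields.YangMills.Theorems.LogWindowMixedDominanceGreenDecayPatterns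
import Literature.Algebra.EuclideanLattices.ShortVectorBoxFinThree
import HarnessLib

/-!
# Decay of second and third differences of the `d = 4` lattice Green function away from the time-zero hyperplane

Support file for crux `LogWindowMixedDominance` (stmt-QuantumFields-26617), stub B `FreeKernelMargin`.  With `G = latticeGreen` on `ℤ⁴`,
sites written `(n, x)` (`Fin.cons n x`, `n` the `e₀`-coordinate, `x : Fin 3 → ℤ`), spatial unit vectors `e_a` (`a : Fin 3`) and the mixed
representation `G(n, x) = (2π)⁻³ ∫_{[-π,π]³} cos(k·x) r^{|n|}/√(ε(ε+2)) dk` (`LogWindowMixedDominanceGreenMixedRepr`), for `n ≥ 1` and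
uniformly in `x` and in the directions:
`|Δ_a Δ_b G(n, x)| ≤ C/n⁴` (two spatial differences), `|Δ_a Δ₀ G(n, x)| ≤ C/n⁴` (one spatial, one temporal), and their temporal
differences `|Δ₀ Δ_a Δ_b G(n,x)|, |Δ₀ Δ_a Δ₀ G(n,x)| ≤ C/n⁵`, with explicit constants — the four patterns needed by the double-curl expansion
of the lattice-Maxwell plaquette kernel for a SPATIAL plaquette against an arbitrary one (pointwise bounds of
`LogWindowMixedDominanceGreenDecayPatterns` + `abs_setIntegral_le_one/_two`).

The continuum heuristics: `G ~ |x|⁻²`, so `∇²G ~ |x|⁻⁴`, `∇³G ~ |x|⁻⁵` (Lawler–Limic 2010 §4.3); only the orders of magnitude are proved and used.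
[folklore]; no rung or summit statement is proved here.
-/

set_option autoImplicit false

noncomputable section

namespace Summit.QuantumFields.YangMills.Theorems.HankelDensitySplitting.LogWindow

namespace GreenDecay

open Real MeasureTheory Set Literature.Probability.LatticeModels
open Summit.QuantumFields.YangMills.Theorems.EquipartitionPinsProbe.Profile (ratio_pos ratio_le_one)

/-! ### The four difference bounds -/

/-- Abbreviation-free form of the mixed representation at a site `(n, y)` with `n : ℕ`. -/
theorem green_cons_nat (n : ℕ) (y : Fin 3 → ℤ) :
    latticeGreen (Fin.cons (n : ℤ) y : Site 4) =
      (∫ k in brillouin 3, Real.cos (∑ i : Fin 3, k i * (y i : ℝ)) *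
        ((1 + dispersion k - Real.sqrt (dispersion k * (dispersion k + 2))) ^ n /
          Real.sqrt (dispersion k * (dispersion k + 2)))) / (2 * π) ^ 3 := by
  rw [GreenRepr.latticeGreen_cons_eq, Int.natAbs_natCast]

/-- Integrability of the mixed integrand at `(n, y)`, `n : ℕ`. -/
theorem integrable_cons_nat (n : ℕ) (y : Fin 3 → ℤ) :
    Integrable (fun k : Fin 3 → ℝ => Real.cos (∑ i : Fin 3, k i * (y i : ℝ)) *
        ((1 + dispersion k - Real.sqrt (dispersion k * (dispersion k + 2))) ^ n /
          Real.sqrt (dispersion k * (dispersion k + 2)))) (volume.restrict (brillouin 3)) := by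
  have h := GreenRepr.integrableOn_mixedIntegrand (n : ℤ) y
  rw [Int.natAbs_natCast] at h
  exact h

/-- **Two spatial differences**: `|Δ_a Δ_b G(n, x)| ≤ (π/2)·(2·12³/(2/(3π))⁴)/n⁴/(2π)³` for `n ≥ 1`. -/
theorem abs_diff_ss_le (a b : Fin 3) {n : ℕ} (hn : 1 ≤ n) (x : Fin 3 → ℤ) :
    |latticeGreen (Fin.cons (n : ℤ) (x + Pi.single a 1 + Pi.single b 1) : Site 4)
        - latticeGreen (Fin.cons (n : ℤ) (x + Pi.single a 1) : Site 4)
        - latticeGreen (Fin.cons (n : ℤ) (x + Pi.single b 1) : Site 4)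
        + latticeGreen (Fin.cons (n : ℤ) x : Site 4)| ≤
      π / 2 * (2 * 12 ^ 3 / (2 / (3 * π)) ^ 4) / (n : ℝ) ^ 4 / (2 * π) ^ 3 := by
  have I3 := integrable_cons_nat n (x + Pi.single a 1 + Pi.single b 1)
  have I1 := integrable_cons_nat n (x + Pi.single a 1)
  have I2 := integrable_cons_nat n (x + Pi.single b 1)
  have I0 := integrable_cons_nat n x
  simp only [phase_add_single] at I3 I1 I2
  rw [green_cons_nat, green_cons_nat, green_cons_nat, green_cons_nat]
  simp only [phase_add_single]
  rw [← sub_div, ← sub_div, ← add_div, abs_div, abs_of_pos (by positivity : (0:ℝ) < (2 * π) ^ 3),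
    integral_combo4 I3 I1 I2 I0]
  refine div_le_div_of_nonneg_right ?_ (by positivity)
  refine abs_setIntegral_le_one (M := π / 2) (by positivity) hn fun k hkB hk0 => ?_
  exact pw_ss hkB hk0 n _ (Literature.Algebra.EuclideanLattices.abs_apply_le_norm k a) (Literature.Algebra.EuclideanLattices.abs_apply_le_norm k b)

/-- **One spatial and one temporal difference**: `|Δ_a Δ₀ G(n, x)| ≤ (2·12³/(2/(3π))⁴)/n⁴/(2π)³` for `n ≥ 1`. -/
theorem abs_diff_s0_le (a : Fin 3) {n : ℕ} (hn : 1 ≤ n) (x : Fin 3 → ℤ) :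
    |latticeGreen (Fin.cons ((n + 1 : ℕ) : ℤ) (x + Pi.single a 1) : Site 4)
        - latticeGreen (Fin.cons (n : ℤ) (x + Pi.single a 1) : Site 4)
        - latticeGreen (Fin.cons ((n + 1 : ℕ) : ℤ) x : Site 4)
        + latticeGreen (Fin.cons (n : ℤ) x : Site 4)| ≤
      1 * (2 * 12 ^ 3 / (2 / (3 * π)) ^ 4) / (n : ℝ) ^ 4 / (2 * π) ^ 3 := by
  have I3 := integrable_cons_nat (n + 1) (x + Pi.single a 1)
  have I1 := integrable_cons_nat n (x + Pi.single a 1)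
  have I2 := integrable_cons_nat (n + 1) x
  have I0 := integrable_cons_nat n x
  simp only [phase_add_single] at I3 I1
  rw [green_cons_nat, green_cons_nat, green_cons_nat, green_cons_nat]
  simp only [phase_add_single]
  rw [← sub_div, ← sub_div, ← add_div, abs_div, abs_of_pos (by positivity : (0:ℝ) < (2 * π) ^ 3),
    integral_combo4 I3 I1 I2 I0]
  refine div_le_div_of_nonneg_right ?_ (by positivity)
  refine abs_setIntegral_le_one (M := 1) zero_le_one hn fun k hkB hk0 => ?_
  exact pw_s0 k n _ (Literature.Algebra.EuclideanLattices.abs_apply_le_norm k a)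

/-- **Temporal difference of two spatial differences**: `|Δ₀ Δ_a Δ_b G(n, x)| ≤ (16·12³/(2/(3π))⁵)/n⁵/(2π)³` for `n ≥ 1`. -/
theorem abs_diff_0ss_le (a b : Fin 3) {n : ℕ} (hn : 1 ≤ n) (x : Fin 3 → ℤ) :
    |(latticeGreen (Fin.cons ((n + 1 : ℕ) : ℤ) (x + Pi.single a 1 + Pi.single b 1) : Site 4)
        - latticeGreen (Fin.cons ((n + 1 : ℕ) : ℤ) (x + Pi.single a 1) : Site 4)
        - latticeGreen (Fin.cons ((n + 1 : ℕ) : ℤ) (x + Pi.single b 1) : Site 4)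
        + latticeGreen (Fin.cons ((n + 1 : ℕ) : ℤ) x : Site 4))
      - (latticeGreen (Fin.cons (n : ℤ) (x + Pi.single a 1 + Pi.single b 1) : Site 4)
        - latticeGreen (Fin.cons (n : ℤ) (x + Pi.single a 1) : Site 4)
        - latticeGreen (Fin.cons (n : ℤ) (x + Pi.single b 1) : Site 4)
        + latticeGreen (Fin.cons (n : ℤ) x : Site 4))| ≤
      1 * (16 * 12 ^ 3 / (2 / (3 * π)) ^ 5) / (n : ℝ) ^ 5 / (2 * π) ^ 3 := by
  have J3 := integrable_cons_nat (n + 1) (x + Pi.single a 1 + Pi.single b 1)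
  have J1 := integrable_cons_nat (n + 1) (x + Pi.single a 1)
  have J2 := integrable_cons_nat (n + 1) (x + Pi.single b 1)
  have J0 := integrable_cons_nat (n + 1) x
  have I3 := integrable_cons_nat n (x + Pi.single a 1 + Pi.single b 1)
  have I1 := integrable_cons_nat n (x + Pi.single a 1)
  have I2 := integrable_cons_nat n (x + Pi.single b 1)
  have I0 := integrable_cons_nat n x
  simp only [phase_add_single] at J3 J1 J2 I3 I1 I2
  rw [green_cons_nat, green_cons_nat, green_cons_nat, green_cons_nat, green_cons_nat, green_cons_nat, green_cons_nat,
    green_cons_nat]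
  simp only [phase_add_single]
  rw [← sub_div, ← sub_div, ← add_div, ← sub_div, ← sub_div, ← add_div, ← sub_div, abs_div,
    abs_of_pos (by positivity : (0:ℝ) < (2 * π) ^ 3), integral_combo44 J3 J1 J2 J0 I3 I1 I2 I0]
  refine div_le_div_of_nonneg_right ?_ (by positivity)
  refine abs_setIntegral_le_two (M := 1) zero_le_one hn fun k hkB hk0 => ?_
  exact pw_0ss k n _ (Literature.Algebra.EuclideanLattices.abs_apply_le_norm k a) (Literature.Algebra.EuclideanLattices.abs_apply_le_norm k b)

/-- **Second temporal difference of one spatial difference**: `|Δ₀ Δ_a Δ₀ G(n, x)| ≤ 7·(16·12³/(2/(3π))⁵)/n⁵/(2π)³` for `n ≥ 1`. -/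
theorem abs_diff_00s_le (a : Fin 3) {n : ℕ} (hn : 1 ≤ n) (x : Fin 3 → ℤ) :
    |(latticeGreen (Fin.cons ((n + 2 : ℕ) : ℤ) (x + Pi.single a 1) : Site 4)
        - latticeGreen (Fin.cons ((n + 1 : ℕ) : ℤ) (x + Pi.single a 1) : Site 4)
        - latticeGreen (Fin.cons ((n + 2 : ℕ) : ℤ) x : Site 4)
        + latticeGreen (Fin.cons ((n + 1 : ℕ) : ℤ) x : Site 4))
      - (latticeGreen (Fin.cons ((n + 1 : ℕ) : ℤ) (x + Pi.single a 1) : Site 4)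
        - latticeGreen (Fin.cons (n : ℤ) (x + Pi.single a 1) : Site 4)
        - latticeGreen (Fin.cons ((n + 1 : ℕ) : ℤ) x : Site 4)
        + latticeGreen (Fin.cons (n : ℤ) x : Site 4))| ≤
      7 * (16 * 12 ^ 3 / (2 / (3 * π)) ^ 5) / (n : ℝ) ^ 5 / (2 * π) ^ 3 := by
  have K3 := integrable_cons_nat (n + 2) (x + Pi.single a 1)
  have K2 := integrable_cons_nat (n + 2) x
  have J3 := integrable_cons_nat (n + 1) (x + Pi.single a 1)
  have J2 := integrable_cons_nat (n + 1) x
  have I3 := integrable_cons_nat n (x + Pi.single a 1)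
  have I2 := integrable_cons_nat n x
  simp only [phase_add_single] at K3 J3 I3
  rw [green_cons_nat, green_cons_nat, green_cons_nat, green_cons_nat, green_cons_nat, green_cons_nat]
  simp only [phase_add_single]
  rw [← sub_div, ← sub_div, ← add_div, ← sub_div, ← sub_div, ← add_div, ← sub_div, abs_div,
    abs_of_pos (by positivity : (0:ℝ) < (2 * π) ^ 3), integral_combo44 K3 J3 K2 J2 J3 I3 J2 I2]
  refine div_le_div_of_nonneg_right ?_ (by positivity)
  refine abs_setIntegral_le_two (M := 7) (by norm_num) hn fun k hkB hk0 => ?_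
  exact pw_00s hkB n _ (Literature.Algebra.EuclideanLattices.abs_apply_le_norm k a)

end GreenDecay

end Summit.QuantumFields.YangMills.Theorems.HankelDensitySplitting.LogWindow

end
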